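/- Copyright: the b2b-balaban cell (near-miss cell 7), T⁴-continuum fan-out; row NE7b OWNER lineage `t4-ne7b-p1`
(gen 59) — «THE PRINTED CHAIN's (N+1)-th SCALE» (kernel companion of RULING R-OWNER-59-1, rider (d2′)).  Released under
the licence of the surrounding project. -/
import Literature.MathematicalPhysics.QuantumFieldTheory.Balaban1983to89.B16StoppingRule

/-!
# «THE PRINTED CHAIN's (N+1)-th SCALE»: the stopping property with condition (i) ALSO at the chain's lowest scale
`K − N` — `StopAtC` — against the tree's `StopAt` (row NE7b, ruling R-OWNER-59-1, located rider (d2′))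

Summits-side support leaf of the T⁴-continuum cell (rung (B)+1 on a FINITE torus only; NOT infinite volume, NOT the
mass gap, NOT the Clay statement; NOT a proof of the spine estimate NE7b — the cell's OWN estimate, NOT PRINTED, NOT
PROVED).  [folklore] elementary bookkeeping (ℕ-arithmetic on window indices + one decided toy in `ℤ¹`) over the
Literature typing `B16StoppingRule` (`CondI`, `CondII`, `StopAt`) BY NAME; no `[cite:]` tag, no `Prop`-valued fact of
Bałaban's minted (`StopAtC` is a PREDICATE with parameters — a hypothesis shape), zero `sorry`.  B15 =
[Balaban1989LargeFieldI] p. 179 and B16 = [Balaban1989LargeFieldII] pp. 384–386 are manuscripts UNDER AUDIT and appear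
only as LOCATORS of which index set is modelled.

WHY (memo `HOME/t4/b2b-balaban-t4-ne7b-p1/g59/D5-FORK-READ.md`, R-OWNER-59-1).  The tree's readiness predicate
`StopAt Nsz N Clean X K = 0 < K ∧ CondI (X K) ∧ CondII … K` inspects condition (i) on the `N` scales `K − N + 1, …, K`
after the formation scale (`CondII`'s `N ≤ K`).  The 𝐑-operation of [B15] §1 is WRITTEN on a nested chain of single
rectangular parallelepipeds with a member at EVERY scale `h, h + 1, …, k`, `h = k − N` (p. 179: «all components of the
domains Z″_j are also rectangular parallelepipeds for j = h, h + 1, …, k»; the successive shell integrations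
`Z″_{j+1} ∖ Z″_j` start at `j = h`) — `N + 1` scales, i.e. (i) is wanted ALSO at the relative scale `K − N`.  At the
formation scale of a birth or a renewal this is automatic (B16 p. 386 «because Z is a small domain … K = R_{j+1}»), which
is why print's `K = R_{j+1}` never discriminated `N` from `N + 1` inspected scales; at a PURE JOIN it is one more (i)-test
of the merged domain.  THIS FILE types the `N + 1`-scale predicate `StopAtC := StopAt ∧ CondI (X (K − N))` and decides,
on the tree's own objects, the located rider (d2′) of R-OWNER-59-1: `StopAtC → StopAt` (print-constructible ⇒ tree-ready:
«tree ready first»); the two coincide whenever (i) holds at `K − N`, in particular at the first candidate `K = N` of a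
line SMALL AT FORMATION; a tree-stop at `K` becomes a chain-stop at `K + 1` as soon as the next scale is clean and
(i)-small (the discrepancy is AT MOST ONE LEVEL); and a decided toy (a line LARGE at formation, small from the next scale
on, `N = 2`) where `StopAt` holds at `K = 2`, `StopAtC` fails at `2` and holds at `3` — the rider is REAL and ONE level.

WHAT.  §1 `StopAtC` + `StopAtC.stopAt`, `stopAtC_iff_of_condI`, `stopAtC_of_stopAt_small_formation`,
`stopAtC_iff_stopAt_at_memory`, `stopAtC_succ_of_stopAt`, `le_of_stopAtC`.  §2 toy `Toy.X` on `Pt 1`: `not_condI_X_zero`,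
`condI_X_succ`, `stopAt_two`, `not_stopAtC_two`, `stopAtC_three`.

HONEST SCOPE.  Index arithmetic on a hypothesis shape and one toy; nothing of Bałaban's asserted, instantiated or
discharged; the cell's process (`HistoryRealiseMemory.StopsM = StopAt 100 (Rm t k) True (orbit …) k`) is NOT edited (a
`StopAtC` twin of the process is a DESIGN NOTE under FREEZE (0), R-OWNER-59-1 (3)); census NONE; R∕T rows by count
UNCHANGED.  NE7b NOT PRINTED ∕ NOT PROVED; spine 0∕9.  HONEST DEPENDENCY (cell): continuum YM on T⁴ ⇐ BetaPertH ∧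
nine spine estimates (0/9 proved); BetaPertH ⇐ (D1) ∧ (D4) ∧ CAP+tail; G-an2-4 gates asym, D1 and NE2/3/4.  This file
changes none of it.
-/

open Literature.MathematicalPhysics.QuantumFieldTheory.Balaban1983to89
open Literature.MathematicalPhysics.QuantumFieldTheory.Balaban1983to89.B13ScaleTransfer (Pt)
open Literature.MathematicalPhysics.QuantumFieldTheory.Balaban1983to89.B16StoppingRule

namespace Summit.QuantumFields.BalabanUV.T4Continuum.HistoryReadinessChainScale

variable {d : ℕ}

/-! ## §1 The `N + 1`-scale stopping property and its comparison with `StopAt` -/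

/-- **`StopAtC Nsz N Clean X K`** — THE STOPPING PROPERTY WITH PRINT's `N + 1`-MEMBER CHAIN: the tree's `StopAt` (K > 0,
(i) at `K`, (ii) inclusive on the `N` scales `K − N + 1, …, K`) AND condition (i) at the chain's lowest scale `K − N`
(the scale `h = k − N` of [B15] p. 179's «j = h, h + 1, …, k»; a LOCATOR, nothing printed asserted).  A hypothesis SHAPE
on a sequence of index-model domains `X : ℕ → Finset (Pt d)` (`X 0` = the domain at its formation scale). [folklore] -/
def StopAtC (Nsz N : ℕ) (Clean : ℕ → Prop) (X : ℕ → Finset (Pt d)) (K : ℕ) : Prop :=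
  StopAt Nsz N Clean X K ∧ CondI Nsz (X (K - N))

/-- print-constructible ⇒ tree-ready («tree ready first»: the chain predicate is the STRONGER one). [folklore] -/
theorem StopAtC.stopAt {Nsz N : ℕ} {Clean : ℕ → Prop} {X : ℕ → Finset (Pt d)} {K : ℕ}
    (h : StopAtC Nsz N Clean X K) : StopAt Nsz N Clean X K :=
  h.1

/-- a chain-stop index is at least the memory `N` (the `N + 1` chain scales `K − N, …, K` end at or after the formation
scale `0`). [folklore] -/
theorem le_of_stopAtC {Nsz N : ℕ} {Clean : ℕ → Prop} {X : ℕ → Finset (Pt d)} {K : ℕ}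
    (h : StopAtC Nsz N Clean X K) : N ≤ K :=
  le_of_stopAt h.1

/-- the two predicates COINCIDE whenever (i) holds at the extra scale `K − N`. [folklore] -/
theorem stopAtC_iff_of_condI {Nsz N : ℕ} {Clean : ℕ → Prop} {X : ℕ → Finset (Pt d)} {K : ℕ}
    (hI : CondI Nsz (X (K - N))) : StopAtC Nsz N Clean X K ↔ StopAt Nsz N Clean X K :=
  ⟨fun h => h.1, fun h => ⟨h, hI⟩⟩

/-- **BIRTHS ∕ RENEWALS**: for a line SMALL AT FORMATION ((i) at the relative scale `0` — B16 p. 386 «because Z is a small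
domain»), a tree-stop at the first candidate index `K = N` IS a chain-stop (the extra scale `K − N` is the formation
scale). [folklore] -/
theorem stopAtC_of_stopAt_small_formation {Nsz N : ℕ} {Clean : ℕ → Prop} {X : ℕ → Finset (Pt d)} {K : ℕ}
    (h : StopAt Nsz N Clean X K) (hK : K = N) (h0 : CondI Nsz (X 0)) : StopAtC Nsz N Clean X K := by
  refine ⟨h, ?_⟩
  subst hK
  simpa using h0

/-- the same as an equivalence at the index `N`. [folklore] -/
theorem stopAtC_iff_stopAt_at_memory {Nsz N : ℕ} {Clean : ℕ → Prop} {X : ℕ → Finset (Pt d)}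
    (h0 : CondI Nsz (X 0)) : StopAtC Nsz N Clean X N ↔ StopAt Nsz N Clean X N :=
  stopAtC_iff_of_condI (by simpa using h0)

/-- past the first candidate (`N < K`) the extra scale `K − N ≥ 1` is one of the scales a tree-stop ONE STEP EARLIER
already inspected: a tree-stop at `K` and a clean, (i)-small scale `K + 1` give a CHAIN-stop at `K + 1` — the discrepancy
between the two predicates is AT MOST ONE LEVEL. [folklore] -/
theorem stopAtC_succ_of_stopAt {Nsz N : ℕ} {Clean : ℕ → Prop} {X : ℕ → Finset (Pt d)} {K : ℕ}
    (h : StopAt Nsz N Clean X K) (hc : Clean (K + 1)) (hI : CondI Nsz (X (K + 1))) :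
    StopAtC Nsz N Clean X (K + 1) := by
  obtain ⟨hK, hIK, hN, hall⟩ := h
  refine ⟨⟨Nat.succ_pos K, hI, by omega, fun l h1 h2 => ?_⟩, ?_⟩
  · rcases Nat.lt_or_ge l (K + 1) with hl | hl
    · exact hall l (by omega) (by omega)
    · obtain rfl : l = K + 1 := le_antisymm h2 hl
      exact ⟨hc, hI⟩
  · -- the extra scale `K + 1 − N`: either `N = 0` (then it is `K + 1`) or it lies in the window `(K − N, K]` of `h`
    rcases Nat.eq_zero_or_pos N with hN0 | hN0
    · subst hN0; simpa using hI
    · exact (hall (K + 1 - N) (by omega) (by omega)).2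

/-- conversely a chain-stop at `K` needs nothing at `K + 1`: the predicates differ ONLY in the scale `K − N`. [folklore] -/
theorem stopAtC_iff {Nsz N : ℕ} {Clean : ℕ → Prop} {X : ℕ → Finset (Pt d)} {K : ℕ} :
    StopAtC Nsz N Clean X K ↔
      0 < K ∧ N ≤ K ∧ CondI Nsz (X K) ∧ CondI Nsz (X (K - N)) ∧
        ∀ l, K < l + N → l ≤ K → Clean l ∧ CondI Nsz (X l) := by
  constructor
  · rintro ⟨⟨hK, hI, hN, hall⟩, h0⟩; exact ⟨hK, hN, hI, h0, hall⟩
  · rintro ⟨hK, hN, hI, h0, hall⟩; exact ⟨⟨hK, hI, hN, hall⟩, h0⟩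

/-! ## §2 Decided toy: a line LARGE at its formation scale and small from the next scale on (`d = 1`, `N = 2`) -/

namespace Toy

/-- the origin of `ℤ¹` [folklore] -/
def p₀ : Pt 1 := fun _ => 0

/-- a far point of `ℤ¹` (coordinate `200`) [folklore] -/
def p₁ : Pt 1 := fun _ => 200

/-- the toy sequence: at the formation scale the two-point domain `{0, 200}` (NOT in a cube of `100` indices per side —
the picture of a pure join of two far constituents), from the next scale on the one-point domain `{0}`. [folklore] -/
def X : ℕ → Finset (Pt 1)
  | 0 => {p₀, p₁}
  | _ + 1 => {p₀}

/-- the formation-scale domain violates (i) with `100` cubes per side. [folklore] -/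
theorem not_condI_X_zero : ¬ CondI 100 (X 0) := by
  rintro ⟨lo, hlo⟩
  have h0 : p₀ ∈ (↑(X 0) : Set (Pt 1)) := by simp [X]
  have h1 : p₁ ∈ (↑(X 0) : Set (Pt 1)) := by simp [X]
  have a := (hlo h0) 0
  have b := (hlo h1) 0
  simp only [p₀, p₁] at a b
  push_cast at a b
  omega

/-- every later domain satisfies (i). [folklore] -/
theorem condI_X_succ (l : ℕ) : CondI 100 (X (l + 1)) := by
  refine ⟨p₀, ?_⟩
  intro c hc i
  have hc' : c = p₀ := by simpa [X] using hc
  subst hc'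
  simp only [p₀, Nat.cast_ofNat]
  omega

/-- (i) at a positive scale, in the form the window lemmas use. [folklore] -/
theorem condI_X_of_pos {l : ℕ} (hl : 0 < l) : CondI 100 (X l) := by
  cases l with
  | zero => exact absurd hl (lt_irrefl 0)
  | succ m => exact condI_X_succ m

/-- THE TREE's predicate holds at the first candidate `K = N = 2` (scales `1, 2` inspected; cleanliness trivial).
[folklore] -/
theorem stopAt_two : StopAt 100 2 (fun _ => True) X 2 :=
  ⟨by norm_num, condI_X_succ 1, by norm_num, fun l h1 h2 => ⟨trivial, condI_X_of_pos (by omega)⟩⟩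

/-- THE CHAIN predicate FAILS there: its extra scale `2 − 2 = 0` is the (i)-large formation scale. [folklore] -/
theorem not_stopAtC_two : ¬ StopAtC 100 2 (fun _ => True) X 2 :=
  fun h => not_condI_X_zero (by simpa using h.2)

/-- … and HOLDS one level later (`K = 3`, chain scales `1, 2, 3`) — the rider is real and is ONE level. [folklore] -/
theorem stopAtC_three : StopAtC 100 2 (fun _ => True) X 3 :=
  stopAtC_succ_of_stopAt stopAt_two trivial (condI_X_succ 2)

end Toy

/-! ## §3 Comparison with the exclusive reading `StopAt'` (INTERFACE REQUEST NE7b IR-59-1, ruling R-OWNER-59-4)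

`B16StoppingRule.StopAt'` — the EXCLUSIVE reading of (ii): `N + 1 ≤ K`, the `N` scales `K − N, …, K − 1` clean and
(i)-small, (i) at `K` — inspects condition (i) on the SAME `N + 1` scales `K − N, …, K` as `StopAtC`.  The two differ
(a) in the cleanliness window at the two edge scales only (`StopAt'` reads `Clean` on `[K − N, K − 1]`, `StopAtC` on
`CondII`'s `[K − N + 1, K]` = print's «preceding N steps»): `stopAtC_of_stopAt'` (needs `Clean K`), `stopAt'_of_stopAtC`
(needs `N < K` and `Clean (K − N)`); and (b) in the FIRST ADMISSIBLE INDEX: `StopAt'` demands `N + 1 ≤ K` (the «+1» booked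
as DIVERGENCE D-b02g9.4), `StopAtC` admits `K = N` with the formation scale as the chain's bottom
(`stopAtC_of_stopAt_small_formation`).  At the process's instantiation `Clean := fun _ => True` this is the HYBRID identity
of R-OWNER-59-4 BY NAME: `stopAtC_true_iff : StopAtC ↔ StopAt' ∨ (K = N ∧ StopAt ∧ CondI (X 0))`, and
`stopAtC_true_iff_stopAt'_of_lt : N < K → (StopAtC ↔ StopAt')`.  On the toy of §2 the exclusive reading fails at `2` and
holds at `3`, like `StopAtC` (`Toy.not_stopAt'_two`, `Toy.stopAt'_three`); the least indices are decided: tree `2`, chain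
`3`, exclusive `3` (`Toy.find_stopAt_eq_two`, `Toy.find_stopAtC_eq_three`, `Toy.find_stopAt'_eq_three`) — «tree ready
first» by exactly ONE level at an (i)-large formation domain.  Ported from leaf-02 g44's NOT-TO-FILE E-datum
E-ne7bleaf02-g44-1 (whose local `StopAtV` has the definiens of `StopAtC`) at the owner's request; [folklore] index
arithmetic on typed letters, nothing of Bałaban's asserted; census NONE; NE7b NOT PRINTED ∕ NOT PROVED; spine 0∕9. -/

/-- exclusive reading + cleanliness at `K` itself ⇒ the chain predicate (the extra scale `K − N` is the bottom of
`CondII'`'s window, or `K` itself when `N = 0`). [folklore] -/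
theorem stopAtC_of_stopAt' {Nsz N : ℕ} {Clean : ℕ → Prop} {X : ℕ → Finset (Pt d)} {K : ℕ}
    (h : StopAt' Nsz N Clean X K) (hc : Clean K) : StopAtC Nsz N Clean X K := by
  obtain ⟨hpos, hIK, hN, hall⟩ := h
  refine ⟨⟨hpos, hIK, by omega, fun l h1 h2 => ?_⟩, ?_⟩
  · rcases Nat.lt_or_ge l K with hl | hl
    · exact hall l (by omega) hl
    · obtain rfl : l = K := le_antisymm h2 hl
      exact ⟨hc, hIK⟩
  · rcases Nat.eq_zero_or_pos N with hN0 | hN0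
    · subst hN0; simpa using hIK
    · exact (hall (K - N) (by omega) (by omega)).2

/-- the chain predicate past the first candidate (`N < K`) + cleanliness at the extra scale `K − N` ⇒ the exclusive
reading. [folklore] -/
theorem stopAt'_of_stopAtC {Nsz N : ℕ} {Clean : ℕ → Prop} {X : ℕ → Finset (Pt d)} {K : ℕ}
    (h : StopAtC Nsz N Clean X K) (hN : N < K) (hc : Clean (K - N)) : StopAt' Nsz N Clean X K := by
  obtain ⟨⟨hpos, hIK, -, hall⟩, hlow⟩ := h
  refine ⟨hpos, hIK, by omega, fun l h1 h2 => ?_⟩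
  rcases Nat.lt_or_ge K (l + N) with hl | hl
  · exact hall l hl (le_of_lt h2)
  · obtain rfl : l = K - N := by omega
    exact ⟨hc, hlow⟩

/-- at `Clean := ⊤` and past the first candidate (`N < K`) the chain predicate IS the landed exclusive reading `StopAt'`.
[folklore] -/
theorem stopAtC_true_iff_stopAt'_of_lt {Nsz N : ℕ} {X : ℕ → Finset (Pt d)} {K : ℕ} (hN : N < K) :
    StopAtC Nsz N (fun _ => True) X K ↔ StopAt' Nsz N (fun _ => True) X K :=
  ⟨fun h => stopAt'_of_stopAtC h hN trivial, fun h => stopAtC_of_stopAt' h trivial⟩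

/-- **THE HYBRID, BY NAME** (R-OWNER-59-4: reading item (d2) re-decided — first admissible index INCLUSIVE, (i)-scale set =
the `N + 1` chain scales): at `Clean := ⊤` the chain predicate = the exclusive reading `StopAt'` OR the first-candidate
case `K = N` of a line (i)-small at formation (births ∕ renewals, B16 p. 386 «because Z is a small domain» as LOCATOR).
[folklore] -/
theorem stopAtC_true_iff {Nsz N : ℕ} {X : ℕ → Finset (Pt d)} {K : ℕ} :
    StopAtC Nsz N (fun _ => True) X K ↔
      StopAt' Nsz N (fun _ => True) X K ∨ (K = N ∧ StopAt Nsz N (fun _ => True) X K ∧ CondI Nsz (X 0)) := by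
  constructor
  · intro h
    rcases Nat.lt_or_ge N K with hlt | hge
    · exact Or.inl ((stopAtC_true_iff_stopAt'_of_lt hlt).1 h)
    · have hK : K = N := le_antisymm hge (le_of_stopAtC h)
      refine Or.inr ⟨hK, h.1, ?_⟩
      have h0 := h.2
      rwa [hK, Nat.sub_self] at h0
  · rintro (h | ⟨hK, h, h0⟩)
    · exact stopAtC_of_stopAt' h trivial
    · exact stopAtC_of_stopAt_small_formation h hK h0

namespace Toy

/-- on the toy of §2 the landed EXCLUSIVE reading also FAILS at the first candidate `K = N = 2` (it needs `N + 1 ≤ K`: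
D-b02g9.4's «+1»). [folklore] -/
theorem not_stopAt'_two : ¬ StopAt' 100 2 (fun _ => True) X 2 :=
  fun h => absurd (lt_of_stopAt' h) (lt_irrefl 2)

/-- … and HOLDS at `K = 3`, like `StopAtC` (`stopAtC_three`, via `stopAtC_true_iff_stopAt'_of_lt`). [folklore] -/
theorem stopAt'_three : StopAt' 100 2 (fun _ => True) X 3 :=
  (stopAtC_true_iff_stopAt'_of_lt (by norm_num)).1 stopAtC_three

open Classical in
/-- THE LEAST INDICES on the toy, decided (`Nat.find` over the classical instance, as `B16StoppingRule` Part 3 leaves it to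
the consumer): the tree's `StopAt` first holds at `2` … [folklore] -/
theorem find_stopAt_eq_two :
    Nat.find (⟨2, stopAt_two⟩ : ∃ K, StopAt 100 2 (fun _ => True) X K) = 2 := by
  rw [Nat.find_eq_iff]
  refine ⟨stopAt_two, fun n hn h => ?_⟩
  have := le_of_stopAt h
  omega

open Classical in
/-- … the chain predicate `StopAtC` first holds at `3` (at `2` it fails: `not_stopAtC_two`) … [folklore] -/
theorem find_stopAtC_eq_three :
    Nat.find (⟨3, stopAtC_three⟩ : ∃ K, StopAtC 100 2 (fun _ => True) X K) = 3 := by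
  rw [Nat.find_eq_iff]
  refine ⟨stopAtC_three, fun n hn h => ?_⟩
  have h2 := le_of_stopAtC h
  interval_cases n
  exact not_stopAtC_two h

open Classical in
/-- … and so does the exclusive reading `StopAt'`: «tree ready first» by exactly ONE level at an (i)-large formation
domain. [folklore] -/
theorem find_stopAt'_eq_three :
    Nat.find (⟨3, stopAt'_three⟩ : ∃ K, StopAt' 100 2 (fun _ => True) X K) = 3 := by
  rw [Nat.find_eq_iff]
  refine ⟨stopAt'_three, fun n hn h => ?_⟩
  have := lt_of_stopAt' h
  omega

end Toy

end Summit.QuantumFields.BalabanUV.T4Continuum.HistoryReadinessChainScale
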